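import Summits.BirchSwinnertonDyer.BirchSwinnertonDyer.Theorems.ByReductionTypeAtTwoMultTowerClass92950cv
import Summits.BirchSwinnertonDyer.BirchSwinnertonDyer.Theorems.ByReductionTypeAtTwoMultTowerClass96138bs
import Summits.BirchSwinnertonDyer.BirchSwinnertonDyer.Theorems.ByReductionTypeAtTwoMultKatoSplitDescent
import HarnessLib

/-!
# M1 ADD-ONS (SPLIT multiplicative `2`), module `SPA07` — descent-keyed displays for 2 tower classes / 4 layer pairs

Cell `bsd-2adic` (run/shared/lean/pub/bsd-2adic/), seat `bsd-2adic-mult` GEN 12, planner spec INBOX 2026-08-27T03:34–03:51Z /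
04:52:45Z (exemplars `plan/m1/M1AddOnExemplar100342a.draft.lean`, `plan/m1/M1SAddOnExemplar101626s.draft.lean`). For each member
`<lab>` below and each certified layer pair `(j,J)` of the class file `ByReductionTypeAtTwoMultTowerClass<cls>.lean`, the theorem
`MultTowerAddOn.bsdp_two_<lab>_l<jJ>_of_descent` is the class file's `MultTowerClass.bsdp_two_<lab>_l<jJ>` with the universal memo binder
`hKato : ∀ W, ¬ W.HasCM → Mult W 2 → O1.KatoMultiplicativeDivisibilityRat W 2` REPLACED by the located inputs {`hne : Kato2004.nonempty_iwasawaH1Data`,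
`h12 : Kato2004.thm12_4`, `hdescS : Kato2004.exists_multDivisibilityInputsDescent_split` (Literature CONSTRUCTION fact, review-accepted p495896; door
`missingUpperBoundAt_two_split_of_towerGapMember_of_descent`, mult GEN 11 p496904) and the universal `hGS` by the MEMBER-LOCAL
`hGS₁ : greenberg_stevens (W := c<lab>) (p := 2)` (PRINT at `2`, referee C ROUND 405),
`h15 : Greenberg1999.thm15_isTorsion_multiplicative_rat`}; every other binder is the class file's, byte for byte, and the tower-gap certificate is
the class file's own `towerGapAtTwo_<lab>_l<jJ>` (its PRINT binders `h33g`/`hM`/`hA`/`hNS2`|`hSP`/`hBDGP`, its Tate datum and its layer counts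
`hlow`/`hup`/`had` pass through verbatim).
Members: 92950cv1, 96138bs1.
HONEST FRAMING: display re-keying only — no class closes here, nothing is booked (D-0054), BSD is not proved by any of this; the tier of
`hdescS` is referee C's word (audit-1 K11-inputs sheets).
-/

-- the Theorems namespace of this sub repeats the summit name by design (D-0017 nested layout: Summit.<S>.<Sub>)
set_option linter.dupNamespace false

noncomputable section

open scoped Classical MatrixGroups ModularForm

open NumberField IsDedekindDomain CongruenceSubgroup WeierstrassCurve Literature.NumberTheory.EllipticCurves
  Literature.NumberTheory.EllipticCurves.ModularForms Literature.NumberTheory.EllipticCurves.Rank1Residual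
  Literature.NumberTheory.EllipticCurves.Rank1Residual.Typed
  Literature.NumberTheory.EllipticCurves.Rank1Residual.X11RankOneCertificates
  Literature.NumberTheory.EllipticCurves.Greenberg1999
  Summit.BirchSwinnertonDyer.Rank1Residual.X5 Summit.BirchSwinnertonDyer.Rank1Residual.X5.O1
  Summit.BirchSwinnertonDyer.Rank1Residual.X5.Instances
  Summit.BirchSwinnertonDyer.BirchSwinnertonDyer.Theorems.KatoHalfPinch
  Summit.BirchSwinnertonDyer.BirchSwinnertonDyer.Theorems.Rank1ResidualX1Defs

namespace Summit.BirchSwinnertonDyer.BirchSwinnertonDyer.Theorems.MultTowerAddOn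

open MultTowerClass

/-- `BSD(92950cv1, 2)` (class `92950cv`, SPLIT at `2`, layer pair `(1,3)`): `MultTowerClass.bsdp_two_92950cv1_l13` DESCENT-KEYED — `hKato`/`hGS` ↦ {`hne`, `h12`, `hdescS`, `h15`} + member-local `hGS₁`;
display = PRINT {h41ns', h41sp, hmod, hGZK, hCassels, hC, hGS₁, h33g, hM, hA, hSP, hBDGP} + `hdescS` + `hr` + CERT {Dq, hkq, hlow, hup, had} + `hsha`. Not a booking. -/
theorem bsdp_two_92950cv1_l13_of_descent
    (hne : Kato2004.nonempty_iwasawaH1Data) (h12 : Kato2004.thm12_4)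
    (hdescS : Kato2004.exists_multDivisibilityInputsDescent_split) (h15 : thm15_isTorsion_multiplicative_rat)
    (h41ns' : thm41Analogue_charValue_rankZero_numberField_anyPrime_oddLocalDegree)
    (h41sp : thm41Analogue_charValue_rankZero_split_baseChange_anyPrime) (hmod : nonempty_modularParametrizationData)
    (hGZK : rank_eq_analyticRank_of_analyticRank_le_one) (hCassels : bsdRHS_eq_of_isIsogenous)
    (hC : cesnavicius_not_two_dvd_maninConstant_of_two_dvd_level) (hGS₁ : greenberg_stevens (W := c92950cv1) (p := 2))
    (h33g : lemma33_localTowerKerPrimary_eq_bot_of_good.{0}) (hM : lemma33_localTowerKerPrimary_cyclic_of_multiplicative.{0})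
    (hA : lemma33_natCard_localTowerKerPrimary_le_four_of_additive.{0})
    (hSP : sec3_natCard_localTowerKerPrimary_splitMultiplicative_rat) (hBDGP : LInvariant_ne_zero (W := c92950cv1) (p := 2))
    (hr : c92950cv1.analyticRank = 0) (Dq : TateParameterData c92950cv1 2) (hkq : (padicLog 2 Dq.q).valuation ≤ (0 : ℤ) + 2)
    {a d : ℕ} (hlow : ∀ κ : ZpExtension ℚ 2, κ.IsCyclotomic → 2 ^ a ≤ Nat.card {z : c92950cv1.selmerLayer κ 1 // 2 • z = 0})
    (hup : ∀ κ : ZpExtension ℚ 2, κ.IsCyclotomic → Nat.card {z : c92950cv1.selmerLayer κ 3 // 2 • z = 0} ≤ 2 ^ d)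
    (had : d + 0 + 0 + 1 ≤ 6 + a) (hsha : MissingLowerBoundAt c92950cv1 2) : BSDp c92950cv1 2 :=
  bsdp_of_missingPPartAt _ 2 hGZK (hr.le.trans zero_le_one) (missingPPartAt_of_lower_of_upper _ 2 hsha
    (missingUpperBoundAt_two_split_of_towerGapMember_of_descent hne h12 hdescS h15 h41ns' h41sp hmod hGZK hCassels hC _ hr
      mult_two_92950cv1 _ (IsIsogenous.refl_holds _) split_two_92950cv1 hGS₁
      (towerGapAtTwo_92950cv1_l13 h33g hM hA hSP hBDGP Dq hkq hlow hup had) (Or.inl irr_two_92950cv1)))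

/-- `BSD(92950cv1, 2)` (class `92950cv`, SPLIT at `2`, layer pair `(2,3)`): `MultTowerClass.bsdp_two_92950cv1_l23` DESCENT-KEYED — `hKato`/`hGS` ↦ {`hne`, `h12`, `hdescS`, `h15`} + member-local `hGS₁`;
display = PRINT {h41ns', h41sp, hmod, hGZK, hCassels, hC, hGS₁, h33g, hM, hA, hSP, hBDGP} + `hdescS` + `hr` + CERT {Dq, hkq, hlow, hup, had} + `hsha`. Not a booking. -/
theorem bsdp_two_92950cv1_l23_of_descent
    (hne : Kato2004.nonempty_iwasawaH1Data) (h12 : Kato2004.thm12_4)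
    (hdescS : Kato2004.exists_multDivisibilityInputsDescent_split) (h15 : thm15_isTorsion_multiplicative_rat)
    (h41ns' : thm41Analogue_charValue_rankZero_numberField_anyPrime_oddLocalDegree)
    (h41sp : thm41Analogue_charValue_rankZero_split_baseChange_anyPrime) (hmod : nonempty_modularParametrizationData)
    (hGZK : rank_eq_analyticRank_of_analyticRank_le_one) (hCassels : bsdRHS_eq_of_isIsogenous)
    (hC : cesnavicius_not_two_dvd_maninConstant_of_two_dvd_level) (hGS₁ : greenberg_stevens (W := c92950cv1) (p := 2))
    (h33g : lemma33_localTowerKerPrimary_eq_bot_of_good.{0}) (hM : lemma33_localTowerKerPrimary_cyclic_of_multiplicative.{0})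
    (hA : lemma33_natCard_localTowerKerPrimary_le_four_of_additive.{0})
    (hSP : sec3_natCard_localTowerKerPrimary_splitMultiplicative_rat) (hBDGP : LInvariant_ne_zero (W := c92950cv1) (p := 2))
    (hr : c92950cv1.analyticRank = 0) (Dq : TateParameterData c92950cv1 2) (hkq : (padicLog 2 Dq.q).valuation ≤ (0 : ℤ) + 2)
    {a d : ℕ} (hlow : ∀ κ : ZpExtension ℚ 2, κ.IsCyclotomic → 2 ^ a ≤ Nat.card {z : c92950cv1.selmerLayer κ 2 // 2 • z = 0})
    (hup : ∀ κ : ZpExtension ℚ 2, κ.IsCyclotomic → Nat.card {z : c92950cv1.selmerLayer κ 3 // 2 • z = 0} ≤ 2 ^ d)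
    (had : d + 0 + 0 + 1 ≤ 4 + a) (hsha : MissingLowerBoundAt c92950cv1 2) : BSDp c92950cv1 2 :=
  bsdp_of_missingPPartAt _ 2 hGZK (hr.le.trans zero_le_one) (missingPPartAt_of_lower_of_upper _ 2 hsha
    (missingUpperBoundAt_two_split_of_towerGapMember_of_descent hne h12 hdescS h15 h41ns' h41sp hmod hGZK hCassels hC _ hr
      mult_two_92950cv1 _ (IsIsogenous.refl_holds _) split_two_92950cv1 hGS₁
      (towerGapAtTwo_92950cv1_l23 h33g hM hA hSP hBDGP Dq hkq hlow hup had) (Or.inl irr_two_92950cv1)))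

/-- `BSD(96138bs1, 2)` (class `96138bs`, SPLIT at `2`, layer pair `(0,3)`): `MultTowerClass.bsdp_two_96138bs1_l03` DESCENT-KEYED — `hKato`/`hGS` ↦ {`hne`, `h12`, `hdescS`, `h15`} + member-local `hGS₁`;
display = PRINT {h41ns', h41sp, hmod, hGZK, hCassels, hC, hGS₁, h33g, hM, hA, hSP, hBDGP} + `hdescS` + `hr` + CERT {Dq, hkq, hlow, hup, had} + `hsha`. Not a booking. -/
theorem bsdp_two_96138bs1_l03_of_descent
    (hne : Kato2004.nonempty_iwasawaH1Data) (h12 : Kato2004.thm12_4)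
    (hdescS : Kato2004.exists_multDivisibilityInputsDescent_split) (h15 : thm15_isTorsion_multiplicative_rat)
    (h41ns' : thm41Analogue_charValue_rankZero_numberField_anyPrime_oddLocalDegree)
    (h41sp : thm41Analogue_charValue_rankZero_split_baseChange_anyPrime) (hmod : nonempty_modularParametrizationData)
    (hGZK : rank_eq_analyticRank_of_analyticRank_le_one) (hCassels : bsdRHS_eq_of_isIsogenous)
    (hC : cesnavicius_not_two_dvd_maninConstant_of_two_dvd_level) (hGS₁ : greenberg_stevens (W := c96138bs1) (p := 2))
    (h33g : lemma33_localTowerKerPrimary_eq_bot_of_good.{0}) (hM : lemma33_localTowerKerPrimary_cyclic_of_multiplicative.{0})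
    (hA : lemma33_natCard_localTowerKerPrimary_le_four_of_additive.{0})
    (hSP : sec3_natCard_localTowerKerPrimary_splitMultiplicative_rat) (hBDGP : LInvariant_ne_zero (W := c96138bs1) (p := 2))
    (hr : c96138bs1.analyticRank = 0) (Dq : TateParameterData c96138bs1 2) (hkq : (padicLog 2 Dq.q).valuation ≤ (0 : ℤ) + 2)
    {a d : ℕ} (hlow : ∀ κ : ZpExtension ℚ 2, κ.IsCyclotomic → 2 ^ a ≤ Nat.card {z : c96138bs1.selmerLayer κ 0 // 2 • z = 0})
    (hup : ∀ κ : ZpExtension ℚ 2, κ.IsCyclotomic → Nat.card {z : c96138bs1.selmerLayer κ 3 // 2 • z = 0} ≤ 2 ^ d)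
    (had : d + 0 + 3 + 1 ≤ 7 + a) (hsha : MissingLowerBoundAt c96138bs1 2) : BSDp c96138bs1 2 :=
  bsdp_of_missingPPartAt _ 2 hGZK (hr.le.trans zero_le_one) (missingPPartAt_of_lower_of_upper _ 2 hsha
    (missingUpperBoundAt_two_split_of_towerGapMember_of_descent hne h12 hdescS h15 h41ns' h41sp hmod hGZK hCassels hC _ hr
      mult_two_96138bs1 _ (IsIsogenous.refl_holds _) split_two_96138bs1 hGS₁
      (towerGapAtTwo_96138bs1_l03 h33g hM hA hSP hBDGP Dq hkq hlow hup had) (Or.inl irr_two_96138bs1)))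

/-- `BSD(96138bs1, 2)` (class `96138bs`, SPLIT at `2`, layer pair `(1,3)`): `MultTowerClass.bsdp_two_96138bs1_l13` DESCENT-KEYED — `hKato`/`hGS` ↦ {`hne`, `h12`, `hdescS`, `h15`} + member-local `hGS₁`;
display = PRINT {h41ns', h41sp, hmod, hGZK, hCassels, hC, hGS₁, h33g, hM, hA, hSP, hBDGP} + `hdescS` + `hr` + CERT {Dq, hkq, hlow, hup, had} + `hsha`. Not a booking. -/
theorem bsdp_two_96138bs1_l13_of_descent
    (hne : Kato2004.nonempty_iwasawaH1Data) (h12 : Kato2004.thm12_4)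
    (hdescS : Kato2004.exists_multDivisibilityInputsDescent_split) (h15 : thm15_isTorsion_multiplicative_rat)
    (h41ns' : thm41Analogue_charValue_rankZero_numberField_anyPrime_oddLocalDegree)
    (h41sp : thm41Analogue_charValue_rankZero_split_baseChange_anyPrime) (hmod : nonempty_modularParametrizationData)
    (hGZK : rank_eq_analyticRank_of_analyticRank_le_one) (hCassels : bsdRHS_eq_of_isIsogenous)
    (hC : cesnavicius_not_two_dvd_maninConstant_of_two_dvd_level) (hGS₁ : greenberg_stevens (W := c96138bs1) (p := 2))
    (h33g : lemma33_localTowerKerPrimary_eq_bot_of_good.{0}) (hM : lemma33_localTowerKerPrimary_cyclic_of_multiplicative.{0})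
    (hA : lemma33_natCard_localTowerKerPrimary_le_four_of_additive.{0})
    (hSP : sec3_natCard_localTowerKerPrimary_splitMultiplicative_rat) (hBDGP : LInvariant_ne_zero (W := c96138bs1) (p := 2))
    (hr : c96138bs1.analyticRank = 0) (Dq : TateParameterData c96138bs1 2) (hkq : (padicLog 2 Dq.q).valuation ≤ (0 : ℤ) + 2)
    {a d : ℕ} (hlow : ∀ κ : ZpExtension ℚ 2, κ.IsCyclotomic → 2 ^ a ≤ Nat.card {z : c96138bs1.selmerLayer κ 1 // 2 • z = 0})
    (hup : ∀ κ : ZpExtension ℚ 2, κ.IsCyclotomic → Nat.card {z : c96138bs1.selmerLayer κ 3 // 2 • z = 0} ≤ 2 ^ d)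
    (had : d + 0 + 3 + 1 ≤ 6 + a) (hsha : MissingLowerBoundAt c96138bs1 2) : BSDp c96138bs1 2 :=
  bsdp_of_missingPPartAt _ 2 hGZK (hr.le.trans zero_le_one) (missingPPartAt_of_lower_of_upper _ 2 hsha
    (missingUpperBoundAt_two_split_of_towerGapMember_of_descent hne h12 hdescS h15 h41ns' h41sp hmod hGZK hCassels hC _ hr
      mult_two_96138bs1 _ (IsIsogenous.refl_holds _) split_two_96138bs1 hGS₁
      (towerGapAtTwo_96138bs1_l13 h33g hM hA hSP hBDGP Dq hkq hlow hup had) (Or.inl irr_two_96138bs1)))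

end Summit.BirchSwinnertonDyer.BirchSwinnertonDyer.Theorems.MultTowerAddOn

end
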